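import Mathlib.Analysis.SpecificLimits.Normed
import Mathlib.Analysis.Normed.Ring.Units
import Mathlib.Analysis.Calculus.ContDiff.Operations
import Mathlib.Algebra.Star.Unitary
import HarnessLib

/-!
# The Cayley transform in a Banach `*`-algebra: unitary interpolation near the identity

Analysis support file (everything proved; two definitions with bodies, no named facts) for the
gauge-gluing step of A. Waldron, Invent. math. 217 (2019), Lemma 3.5 / §4 (a global small gauge
on a sphere is glued from two local ones; the transition unitary, close to `1`, is interpolated
to `1` THROUGH UNITARIES without `exp`/`log`):

* `cayleyU T = (1 + T)(1 − T)⁻¹` (`Ring.inverse`), `cayleyUInv W = (W − 1)(W + 1)⁻¹`;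
* `isUnit_one_sub_of_norm_lt`, `norm_ringInverse_one_sub_le` — Neumann series;
* `cayleyU_zero`, `star_cayleyU_mul_self`, `cayleyU_mul_star_self`, `cayleyU_mem_unitary` —
  `cayleyU T` is unitary for skew `T` (`star T = −T`) with `‖T‖ < 1`;
* `cayleyU_sub_one`, `norm_cayleyU_sub_one_le` — `cayleyU T − 1 = 2T(1−T)⁻¹`;
* `contDiffAt_cayleyU` — smoothness on `‖T‖ < 1`;
* `star_cayleyUInv`, `cayleyU_cayleyUInv`, `norm_cayleyUInv_le`, `contDiffAt_cayleyUInv` — the inverse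
  transform of a unitary `W` with `‖W − 1‖ < 2` is skew and is mapped back to `W`.

References: A. Waldron, Invent. math. 217 (2019), §3–§4 [Waldron2019]; [folklore].
-/

noncomputable section

open Set Metric Filter
open scoped Topology

namespace Literature.Analysis.OperatorTheory

variable {R : Type*} [NormedRing R] [CompleteSpace R]

/-! ### Neumann series facts -/

/-- `1 − T` is a unit for `‖T‖ < 1`. [folklore] -/
theorem isUnit_one_sub_of_norm_lt {T : R} (hT : ‖T‖ < 1) : IsUnit (1 - T) :=
  isUnit_one_sub_of_norm_lt_one hT

/-- `1 + T` is a unit for `‖T‖ < 1`. [folklore] -/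
theorem isUnit_one_add_of_norm_lt {T : R} (hT : ‖T‖ < 1) : IsUnit (1 + T) := by
  have h := isUnit_one_sub_of_norm_lt (T := -T) (by rwa [norm_neg])
  rwa [sub_neg_eq_add] at h

/-- **Norm of the Neumann inverse**: `‖(1 − T)⁻¹‖ ≤ ‖1‖ − 1 + (1 − ‖T‖)⁻¹`. [folklore] -/
theorem norm_ringInverse_one_sub_le {T : R} (hT : ‖T‖ < 1) :
    ‖Ring.inverse (1 - T)‖ ≤ ‖(1 : R)‖ - 1 + (1 - ‖T‖)⁻¹ := by
  rw [← geom_series_eq_inverse T hT]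
  exact tsum_geometric_le_of_norm_lt_one T hT

/-- For `‖T‖ ≤ 1/2`: `‖(1 − T)⁻¹‖ ≤ ‖1‖ + 1`. [folklore] -/
theorem norm_ringInverse_one_sub_le_of_le_half {T : R} (hT : ‖T‖ ≤ 1 / 2) :
    ‖Ring.inverse (1 - T)‖ ≤ ‖(1 : R)‖ + 1 := by
  have h := norm_ringInverse_one_sub_le (T := T) (by linarith)
  have h2 : (1 - ‖T‖)⁻¹ ≤ 2 := by
    rw [inv_le_comm₀ (by linarith) (by norm_num)]
    linarith
  linarith

omit [CompleteSpace R] in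
/-- Commuting with a unit means commuting with its `Ring.inverse`. [folklore] -/
theorem mul_ringInverse_comm {a b : R} (hab : a * b = b * a) (hb : IsUnit b) :
    a * Ring.inverse b = Ring.inverse b * a := by
  calc a * Ring.inverse b = Ring.inverse b * b * a * Ring.inverse b := by
        rw [Ring.inverse_mul_cancel b hb, one_mul]
    _ = Ring.inverse b * (a * b) * Ring.inverse b := by rw [mul_assoc (Ring.inverse b), hab]
    _ = Ring.inverse b * a := by
        rw [← mul_assoc, mul_assoc, Ring.mul_inverse_cancel b hb, mul_one]

/-! ### The Cayley transform -/

/-- **The Cayley transform** `T ↦ (1 + T)(1 − T)⁻¹`. [folklore] -/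
def cayleyU (T : R) : R := (1 + T) * Ring.inverse (1 - T)

omit [CompleteSpace R] in
/-- `cayleyU 0 = 1`. [folklore] -/
theorem cayleyU_zero : cayleyU (0 : R) = 1 := by
  simp [cayleyU, Ring.inverse_one]

section RealAlgebra

variable [NormedAlgebra ℝ R]

/-- `cayleyU T − 1 = 2T(1 − T)⁻¹` for `‖T‖ < 1`. [folklore] -/
theorem cayleyU_sub_one {T : R} (hT : ‖T‖ < 1) :
    cayleyU T - 1 = (2 : ℝ) • (T * Ring.inverse (1 - T)) := by
  have hu := isUnit_one_sub_of_norm_lt hT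
  have h1 : (1 : R) = (1 - T) * Ring.inverse (1 - T) := (Ring.mul_inverse_cancel _ hu).symm
  calc cayleyU T - 1 = (1 + T) * Ring.inverse (1 - T) - (1 - T) * Ring.inverse (1 - T) := by
        rw [cayleyU, ← h1]
    _ = ((1 + T) - (1 - T)) * Ring.inverse (1 - T) := by noncomm_ring
    _ = (2 : ℝ) • (T * Ring.inverse (1 - T)) := by
        rw [show (1 + T) - (1 - T) = (2 : ℝ) • T by rw [two_smul]; abel, smul_mul_assoc]

/-- **`‖cayleyU T − 1‖ ≤ 2(‖1‖ + 1)‖T‖`** for `‖T‖ ≤ 1/2`. [folklore] -/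
theorem norm_cayleyU_sub_one_le {T : R} (hT : ‖T‖ ≤ 1 / 2) :
    ‖cayleyU T - 1‖ ≤ 2 * (‖(1 : R)‖ + 1) * ‖T‖ := by
  have hT1 : ‖T‖ < 1 := by linarith
  rw [cayleyU_sub_one hT1, norm_smul, Real.norm_eq_abs, abs_of_pos two_pos]
  have h := norm_ringInverse_one_sub_le_of_le_half hT
  calc 2 * ‖T * Ring.inverse (1 - T)‖ ≤ 2 * (‖T‖ * ‖Ring.inverse (1 - T)‖) :=
        mul_le_mul_of_nonneg_left (norm_mul_le _ _) two_pos.le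
    _ ≤ 2 * (‖T‖ * (‖(1 : R)‖ + 1)) := by
        refine mul_le_mul_of_nonneg_left (mul_le_mul_of_nonneg_left h (norm_nonneg _)) two_pos.le
    _ = 2 * (‖(1 : R)‖ + 1) * ‖T‖ := by ring

/-- **Smoothness of the Cayley transform** at points with `‖T‖ < 1`. [folklore] -/
theorem contDiffAt_cayleyU {n : WithTop ℕ∞} {T : R} (hT : ‖T‖ < 1) : ContDiffAt ℝ n cayleyU T := by
  obtain ⟨u, hu⟩ := isUnit_one_sub_of_norm_lt hT
  have h1 : ContDiffAt ℝ n (fun S : R => 1 + S) T := contDiffAt_const.add contDiffAt_id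
  have h2 : ContDiffAt ℝ n (fun S : R => Ring.inverse (1 - S)) T := by
    have hi : ContDiffAt ℝ n Ring.inverse ((1 : R) - T) := by
      rw [← hu]; exact contDiffAt_ringInverse ℝ u
    exact hi.comp T (contDiffAt_const.sub contDiffAt_id)
  exact h1.mul h2

end RealAlgebra

section Star

variable [StarRing R]

/-- **`(cayleyU T)⋆ (cayleyU T) = 1`** for skew `T` with `‖T‖ < 1`. [folklore] -/
theorem star_cayleyU_mul_self {T : R} (hT : ‖T‖ < 1) (hskew : star T = -T) :
    star (cayleyU T) * cayleyU T = 1 := by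
  have hu := isUnit_one_sub_of_norm_lt hT
  have hu' := isUnit_one_add_of_norm_lt hT
  -- `(cayleyU T)⋆ = (1 + T)⁻¹ (1 − T)`
  have hstar : star (cayleyU T) = Ring.inverse (1 + T) * (1 - T) := by
    rw [cayleyU, star_mul, ← Ring.inverse_star, star_sub, star_add, star_one, hskew, sub_neg_eq_add,
      ← sub_eq_add_neg]
  -- `(1 − T)` and `(1 + T)` commute
  have hcomm : (1 - T) * (1 + T) = (1 + T) * (1 - T) := by noncomm_ring
  rw [hstar, cayleyU, mul_assoc, ← mul_assoc (1 - T), hcomm, mul_assoc, ← mul_assoc (Ring.inverse (1 + T)),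
    Ring.inverse_mul_cancel _ hu', one_mul, Ring.mul_inverse_cancel _ hu]

/-- **`(cayleyU T)(cayleyU T)⋆ = 1`** for skew `T` with `‖T‖ < 1`. [folklore] -/
theorem cayleyU_mul_star_self {T : R} (hT : ‖T‖ < 1) (hskew : star T = -T) :
    cayleyU T * star (cayleyU T) = 1 := by
  have hu := isUnit_one_sub_of_norm_lt hT
  have hu' := isUnit_one_add_of_norm_lt hT
  have hstar : star (cayleyU T) = Ring.inverse (1 + T) * (1 - T) := by
    rw [cayleyU, star_mul, ← Ring.inverse_star, star_sub, star_add, star_one, hskew, sub_neg_eq_add,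
      ← sub_eq_add_neg]
  -- move `(1 − T)⁻¹` past `(1 + T)⁻¹ (1 − T)` using commutativity
  have hcomm : (1 - T) * (1 + T) = (1 + T) * (1 - T) := by noncomm_ring
  have hc1 : Ring.inverse (1 - T) * Ring.inverse (1 + T) = Ring.inverse (1 + T) * Ring.inverse (1 - T) := by
    have h := mul_ringInverse_comm (a := Ring.inverse (1 - T)) (b := 1 + T)
      (mul_ringInverse_comm hcomm.symm hu).symm hu'
    exact h
  rw [hstar, cayleyU, mul_assoc, ← mul_assoc (Ring.inverse (1 - T)), hc1, mul_assoc,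
    Ring.inverse_mul_cancel _ hu, mul_one, Ring.mul_inverse_cancel _ hu']

/-- **The Cayley transform of a small skew element is unitary.** [folklore] -/
theorem cayleyU_mem_unitary {T : R} (hT : ‖T‖ < 1) (hskew : star T = -T) : cayleyU T ∈ unitary R :=
  Unitary.mem_iff.2 ⟨star_cayleyU_mul_self hT hskew, cayleyU_mul_star_self hT hskew⟩

end Star

/-! ### The inverse transform of a unitary close to `1` -/

/-- **The inverse Cayley transform** `W ↦ (W − 1)(W + 1)⁻¹`. [folklore] -/
def cayleyUInv (W : R) : R := (W - 1) * Ring.inverse (W + 1)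

section Inverse

variable [NormedAlgebra ℝ R]

omit [CompleteSpace R] in
/-- `W + 1 = 2(1 − T')` with `T' = −½(W − 1)`; `‖T'‖ = ½‖W − 1‖`. [folklore] -/
theorem add_one_eq_smul (W : R) : W + 1 = (2 : ℝ) • (1 - ((-(1 / 2 : ℝ)) • (W - 1))) := by
  rw [neg_smul, sub_neg_eq_add, smul_add, smul_smul]
  norm_num
  rw [two_smul]; abel

/-- `W + 1` is a unit when `‖W − 1‖ < 2`. [folklore] -/
theorem isUnit_add_one {W : R} (hW : ‖W - 1‖ < 2) : IsUnit (W + 1) := by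
  have hT : ‖(-(1 / 2 : ℝ)) • (W - 1)‖ < 1 := by
    rw [norm_smul, norm_neg, Real.norm_eq_abs, abs_of_pos (by norm_num : (0 : ℝ) < 1 / 2)]
    linarith
  have hu := isUnit_one_sub_of_norm_lt hT
  rw [add_one_eq_smul]
  have h2 : IsUnit (algebraMap ℝ R 2) := (IsUnit.mk0 (2 : ℝ) two_ne_zero).map _
  rw [Algebra.smul_def]
  exact h2.mul hu

/-- **Norm of `(W + 1)⁻¹`**: `≤ ½(‖1‖ + 1)` for `‖W − 1‖ ≤ 1`. [folklore] -/
theorem norm_ringInverse_add_one_le {W : R} (hW : ‖W - 1‖ ≤ 1) :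
    ‖Ring.inverse (W + 1)‖ ≤ (1 / 2) * (‖(1 : R)‖ + 1) := by
  set T : R := (-(1 / 2 : ℝ)) • (W - 1) with hT_def
  have hT : ‖T‖ ≤ 1 / 2 := by
    rw [hT_def, norm_smul, norm_neg, Real.norm_eq_abs, abs_of_pos (by norm_num : (0 : ℝ) < 1 / 2)]
    linarith
  have hu := isUnit_one_sub_of_norm_lt (T := T) (by linarith)
  have h2u : IsUnit (algebraMap ℝ R 2) := (IsUnit.mk0 (2 : ℝ) two_ne_zero).map _
  -- `(W + 1)⁻¹ = ½ (1 − T)⁻¹`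
  have hinv : Ring.inverse (W + 1) = (1 / 2 : ℝ) • Ring.inverse (1 - T) := by
    have hW1 : W + 1 = algebraMap ℝ R 2 * (1 - T) := by rw [add_one_eq_smul, Algebra.smul_def]
    have hprod : (W + 1) * ((1 / 2 : ℝ) • Ring.inverse (1 - T)) = 1 := by
      rw [hW1, mul_smul_comm, mul_assoc, Ring.mul_inverse_cancel _ hu, mul_one, Algebra.algebraMap_eq_smul_one,
        smul_smul]
      norm_num
    have hWu : IsUnit (W + 1) := by rw [hW1]; exact h2u.mul hu
    obtain ⟨u, hu'⟩ := hWu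
    rw [← hu', Ring.inverse_unit]
    rw [← hu'] at hprod
    calc ((u⁻¹ : Rˣ) : R) = ((u⁻¹ : Rˣ) : R) * ((u : R) * ((1 / 2 : ℝ) • Ring.inverse (1 - T))) := by
          rw [hprod, mul_one]
      _ = (1 / 2 : ℝ) • Ring.inverse (1 - T) := by rw [← mul_assoc, Units.inv_mul, one_mul]
  rw [hinv, norm_smul, Real.norm_eq_abs, abs_of_pos (by norm_num : (0 : ℝ) < 1 / 2)]
  exact mul_le_mul_of_nonneg_left (norm_ringInverse_one_sub_le_of_le_half hT) (by norm_num)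

/-- **`‖cayleyUInv W‖ ≤ ½(‖1‖ + 1)‖W − 1‖`** for `‖W − 1‖ ≤ 1`. [folklore] -/
theorem norm_cayleyUInv_le {W : R} (hW : ‖W - 1‖ ≤ 1) :
    ‖cayleyUInv W‖ ≤ (1 / 2) * (‖(1 : R)‖ + 1) * ‖W - 1‖ := by
  rw [cayleyUInv]
  calc ‖(W - 1) * Ring.inverse (W + 1)‖ ≤ ‖W - 1‖ * ‖Ring.inverse (W + 1)‖ := norm_mul_le _ _
    _ ≤ ‖W - 1‖ * ((1 / 2) * (‖(1 : R)‖ + 1)) :=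
        mul_le_mul_of_nonneg_left (norm_ringInverse_add_one_le hW) (norm_nonneg _)
    _ = (1 / 2) * (‖(1 : R)‖ + 1) * ‖W - 1‖ := by ring

/-- **Smoothness of the inverse transform** at `W` with `‖W − 1‖ < 2`. [folklore] -/
theorem contDiffAt_cayleyUInv {n : WithTop ℕ∞} {W : R} (hW : ‖W - 1‖ < 2) :
    ContDiffAt ℝ n cayleyUInv W := by
  obtain ⟨u, hu⟩ := isUnit_add_one hW
  have h1 : ContDiffAt ℝ n (fun V : R => V - 1) W := contDiffAt_id.sub contDiffAt_const
  have h2 : ContDiffAt ℝ n (fun V : R => Ring.inverse (V + 1)) W := by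
    have hi : ContDiffAt ℝ n Ring.inverse (W + 1) := by
      rw [← hu]; exact contDiffAt_ringInverse ℝ u
    exact hi.comp W (contDiffAt_id.add contDiffAt_const)
  exact h1.mul h2

/-- **`cayleyU (cayleyUInv W) = W`** when `W + 1` is a unit and `‖cayleyUInv W‖ < 1`. [folklore] -/
theorem cayleyU_cayleyUInv {W : R} (hW : ‖W - 1‖ < 2) (hS : ‖cayleyUInv W‖ < 1) :
    cayleyU (cayleyUInv W) = W := by
  set S := cayleyUInv W with hS_def
  have hWu := isUnit_add_one hW
  have h1S := isUnit_one_sub_of_norm_lt hS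
  -- `W (1 − S) = 1 + S`
  have hcomm : (W + 1) * (W - 1) = (W - 1) * (W + 1) := by noncomm_ring
  have hkey : W * (1 - S) = 1 + S := by
    have h2 : (1 + W) * S = W - 1 := by
      rw [hS_def, cayleyUInv, ← mul_assoc, show (1 + W) = W + 1 by abel, hcomm, mul_assoc,
        Ring.mul_inverse_cancel _ hWu, mul_one]
    have h3 : W - 1 = S + W * S := by rw [← h2]; noncomm_ring
    calc W * (1 - S) = (W - 1) - W * S + 1 := by noncomm_ring
      _ = (S + W * S) - W * S + 1 := by rw [h3]
      _ = 1 + S := by abel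
  calc cayleyU S = (1 + S) * Ring.inverse (1 - S) := rfl
    _ = W * (1 - S) * Ring.inverse (1 - S) := by rw [hkey]
    _ = W := Ring.mul_inverse_cancel_right _ _ h1S

end Inverse

section InverseStar

variable [StarRing R]

omit [CompleteSpace R] in
/-- **The inverse transform of a unitary is skew**: `star (cayleyUInv W) = −cayleyUInv W` for
`W⋆W = 1` with `W + 1` a unit. [folklore] -/
theorem star_cayleyUInv {W : R} (hWu : IsUnit (W + 1)) (h1 : star W * W = 1) :
    star (cayleyUInv W) = -cayleyUInv W := by
  have hWu' : IsUnit (star W + 1) := by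
    have := hWu.star; rwa [star_add, star_one] at this
  -- cancel the unit `W + 1` on the right
  have hR : star (cayleyUInv W) * (W + 1) = -cayleyUInv W * (W + 1) := by
    have hr : -cayleyUInv W * (W + 1) = 1 - W := by
      rw [cayleyUInv, neg_mul, mul_assoc, Ring.inverse_mul_cancel _ hWu, mul_one]; abel
    have hl : star (cayleyUInv W) * (W + 1) = 1 - W := by
      rw [cayleyUInv, star_mul, ← Ring.inverse_star, star_add, star_one, star_sub, star_one]
      -- `(W⋆+1)⁻¹ (W⋆ − 1)(W + 1) = (W⋆+1)⁻¹ (W⋆ − W) = 1 − W`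
      have hx : (star W - 1) * (W + 1) = (star W + 1) * (1 - W) := by
        have e1 : (star W - 1) * (W + 1) = star W * W + star W - W - 1 := by noncomm_ring
        have e2 : (star W + 1) * (1 - W) = star W - star W * W + 1 - W := by noncomm_ring
        rw [e1, e2, h1]; abel
      rw [mul_assoc, hx, ← mul_assoc, Ring.inverse_mul_cancel _ hWu', one_mul]
    rw [hl, hr]
  obtain ⟨u, hu⟩ := hWu
  rw [← hu] at hR
  exact Units.mul_left_inj u |>.1 hR

end InverseStar

end Literature.Analysis.OperatorTheory
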